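import Summits.CriticalPhenomena.PercolationContinuityZ3.Theorems.Transplant.SkelPhiQStepSelectionChart
import Summits.CriticalPhenomena.PercolationContinuityZ3.Theorems.Transplant.SkelPhiQStepSelectionTree
import HarnessLib

/-!
# Quasi-step SELECTION, IV: SINGLE-EDGE STEP MAPS for a quasi-step chart — exact footprint, suffix-consistent by construction, finite closures, finite hulls

builds on p205010 (kernel theorem, internal audit signed; external expert review pending) — nothing in this file uses p205010 and nothing here is a
percolation statement or a claim about any node.  Lane `prim-bschramm`, seat `prim-bschramm-p5` gen 30 (refuter / sharpness seat; planning memo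
HOME/prim-bschramm-p5-g30/Q3-R1.md §4, risks R1 + R3).  Helper file (`--supports stmt-CriticalPhenomena-4575 --as helper`).

For a chart `F : V → ℤ²` with `Skelφ.QStepsN G F N` on a connected locally finite graph, the geodesic pointers of file III on the fibre graph of file II give
**`exists_qptr`**: step maps `st i : V → V` (`i = 0, 1`) along EDGES of `G` with RANKS `rk i : V → ℕ` (`rk + 1 ≤ N`): at rank `0` the step raises
coordinate `i` by one, at positive rank it is a fibre hop (same chart value) lowering the rank by one — so `rk i z` fibre hops then the raising edge realise the
unit move with the EXACT footprint (`iterate_of_qptr`), the fibre iterates are pairwise distinct (ranks), and the iterates from any intermediate vertex are the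
tail (the suffix-consistency the tails clause of the ray kits needs) — and every closure under "follow a fibre hop of either step map" is FINITE; **`finite_ptrClosure`**: closures that spawn only at chart values of bounded
potential `c 0 + c 1` are finite (the single-edge `finite_hull` of the scaled template «PlanarSkeletonFrmScaledRayHull», quasi version).
[cite: AizenmanGrimmett1991, §2 (finite regions)] [cite: KozmaNitzan2024, §4 p. 19 (Step III)]
-/

noncomputable section

namespace Summit.CriticalPhenomena.PercolationContinuityZ3.Theorems.Transplant

namespace Skelφ

open SimpleGraph Literature.Probability.LatticeModels
open Literature.Barriers.CriticalPhenomena (countable_of_connected_of_locallyFinite)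
open scoped Classical

variable {V : Type} {G : SimpleGraph V} {F : V → Site 2} {N : ℕ}

/-- A unit vector is nonzero. [folklore] -/
private theorem single_one_ne_zero' (i : Fin 2) : (Pi.single i 1 : Site 2) ≠ 0 :=
  fun h => one_ne_zero (Pi.single_injective i (h.trans (Pi.single_zero i).symm))

/-! ## §1 Single-edge step maps from geodesic pointers -/

/-- **SINGLE-EDGE STEP MAPS WITH EXACT FOOTPRINT, SUFFIX-CONSISTENT, FINITE CLOSURES**: for a chart with quasi-steps of cost `N` on a connected locally
finite graph there are step maps `st 0, st 1 : V → V` and RANKS `rk 0, rk 1 : V → ℕ` (`rk i z + 1 ≤ N`) with: every `st i z` is a `G`-neighbour of `z`;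
at rank `0` the step RAISES coordinate `i` by one, at positive rank it is a FIBRE HOP (same chart value) lowering the rank by one — so from `z` exactly
`rk i z` fibre hops are followed by the raising edge, the iterates are pairwise distinct inside the fibre, and the iterates from any intermediate vertex are
the tail (suffix-consistency); and every closure under the fibre hops of both maps is FINITE. [this work] -/
theorem exists_qptr [G.LocallyFinite] (hc : G.Connected) (hq : QStepsN G F N) :
    ∃ (st : Fin 2 → V → V) (rk : Fin 2 → V → ℕ),
      (∀ i z, G.Adj z (st i z)) ∧ (∀ i z, rk i z + 1 ≤ N) ∧
      (∀ i z, rk i z = 0 → F (st i z) = F z + Pi.single i 1) ∧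
      (∀ i z, rk i z ≠ 0 → F (st i z) = F z ∧ rk i (st i z) + 1 = rk i z) ∧
      ∀ v, {x | Relation.ReflTransGen (fun a b => ∃ i, b = st i a ∧ F b = F a) v x}.Finite := by
  rcases isEmpty_or_nonempty V with hV | ⟨⟨v₀⟩⟩
  · exact ⟨fun _ v => v, fun _ _ => 0, fun _ v => isEmptyElim v, fun _ v => isEmptyElim v, fun _ v => isEmptyElim v,
      fun _ v => isEmptyElim v, fun v => isEmptyElim v⟩
  haveI : Countable V := countable_of_connected_of_locallyFinite G hc v₀
  have hJ : QSel.Joined (fib G F) (port G F) (N - 1) := joined_of_qStepsN hq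
  obtain ⟨nx, hgood, hfin⟩ := QSel.exists_goodPtr hJ
  have hN : 1 ≤ N := by
    obtain ⟨w', hF, p, hp, -⟩ := hq v₀ 0 1
    rw [Units.val_one] at hF
    rcases p with _ | ⟨h, p'⟩
    · exact (single_one_ne_zero' 0 (by simpa using hF.symm)).elim
    · rw [Walk.length_cons] at hp; omega
  -- the exit edge at a port
  have hport : ∀ (i : Fin 2) (z : V), QSel.pd hJ i z = 0 → ∃ u', G.Adj z u' ∧ F u' = F z + Pi.single i 1 :=
    fun i z h => (QSel.pd_eq_zero_iff hJ i z).1 h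
  choose ex hexadj hexF using hport
  let st : Fin 2 → V → V := fun i z => if h : QSel.pd hJ i z = 0 then ex i z h else nx i z
  have hst0 : ∀ i z (h : QSel.pd hJ i z = 0), st i z = ex i z h := fun i z h => by simp only [st, dif_pos h]
  have hst1 : ∀ i z, QSel.pd hJ i z ≠ 0 → st i z = nx i z := fun i z h => by simp only [st, dif_neg h]
  refine ⟨st, fun i z => QSel.pd hJ i z, fun i z => ?_, fun i z => ?_, fun i z h => ?_, fun i z h => ?_,
    fun v => (hfin v).subset fun x hx => ?_⟩
  · by_cases h : QSel.pd hJ i z = 0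
    · rw [hst0 i z h]; exact hexadj i z h
    · rw [hst1 i z h]; exact (hgood i z h).1.1
  · show QSel.pd hJ i z + 1 ≤ N
    have := QSel.pd_le_m hJ i z; omega
  · rw [hst0 i z h]; exact hexF i z h
  · rw [hst1 i z h]; exact ⟨(hgood i z h).1.2.symm, (hgood i z h).2⟩
  · have hx' : Relation.ReflTransGen (fun a b => ∃ i, b = st i a ∧ F b = F a) v x := hx
    show Relation.ReflTransGen _ v x
    clear hx
    induction hx' with
    | refl => exact Relation.ReflTransGen.refl
    | tail _ hbc ih =>
      obtain ⟨i, rfl, hFb⟩ := hbc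
      rename_i a _
      have h : QSel.pd hJ i a ≠ 0 := by
        intro h
        rw [hst0 i a h, hexF i a h, add_eq_left] at hFb
        exact single_one_ne_zero' i hFb
      exact ih.tail ⟨i, h, hst1 i a h⟩

/-- **The macro-step from the single-edge data**: `rk i z` fibre hops, then the raising edge. [this work] -/
theorem iterate_of_qptr {st : Fin 2 → V → V} {rk : Fin 2 → V → ℕ}
    (h0 : ∀ i z, rk i z = 0 → F (st i z) = F z + Pi.single i 1)
    (h1 : ∀ i z, rk i z ≠ 0 → F (st i z) = F z ∧ rk i (st i z) + 1 = rk i z) (i : Fin 2) :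
    ∀ (k : ℕ) (z : V), rk i z = k → (∀ j ≤ k, F ((st i)^[j] z) = F z ∧ rk i ((st i)^[j] z) + j = k) ∧
      F ((st i)^[k + 1] z) = F z + Pi.single i 1 := by
  intro k
  induction k with
  | zero =>
    intro z hz
    refine ⟨fun j hj => by rw [Nat.le_zero.mp hj]; exact ⟨rfl, by simpa using hz⟩, ?_⟩
    rw [Function.iterate_one]; exact h0 i z hz
  | succ k ih =>
    intro z hz
    have hne : rk i z ≠ 0 := by omega
    obtain ⟨hF1, hr1⟩ := h1 i z hne
    obtain ⟨ihj, ihk⟩ := ih (st i z) (by omega)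
    refine ⟨fun j hj => ?_, ?_⟩
    · rcases j with _ | j
      · exact ⟨rfl, by simpa using hz⟩
      · rw [Function.iterate_succ_apply]
        obtain ⟨hFj, hrj⟩ := ihj j (by omega)
        exact ⟨hFj.trans hF1, by omega⟩
    · rw [Function.iterate_succ_apply, ihk, hF1]

/-! ## §2 Finite hulls for single-edge step maps -/

/-- **FINITE HULLS (single-edge form)**: with step maps as in `exists_qptr`, the closure of a vertex under "at a vertex whose chart value lies in the
spawning region `B`, add both successors" is FINITE whenever the potential `c 0 + c 1` is bounded above on `B`. [this work] -/
theorem finite_ptrClosure {st : Fin 2 → V → V}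
    (hF : ∀ i z, F (st i z) = F z ∨ F (st i z) = F z + Pi.single i 1)
    (hfin : ∀ v, {x | Relation.ReflTransGen (fun a b => ∃ i, b = st i a ∧ F b = F a) v x}.Finite)
    (B : Set (Site 2)) (K : ℤ) (hB : ∀ c ∈ B, c 0 + c 1 ≤ K) (v : V) :
    {x | Relation.ReflTransGen (fun a b => F a ∈ B ∧ ∃ i, b = st i a) v x}.Finite := by
  let Fr : V → V → Prop := fun a b => ∃ i, b = st i a ∧ F b = F a
  let Sp : V → V → Prop := fun a b => F a ∈ B ∧ ∃ i, b = st i a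
  have hFr : ∀ {a b}, Relation.ReflTransGen Fr a b → F b = F a := by
    intro a b h
    induction h with
    | refl => rfl
    | tail _ hbc ih => obtain ⟨-, -, h⟩ := hbc; rw [h, ih]
  have hdec : ∀ {a x}, Relation.ReflTransGen Sp a x → Relation.ReflTransGen Fr a x ∨
      ∃ a', Relation.ReflTransGen Fr a a' ∧ F a' ∈ B ∧ ∃ i, F (st i a') = F a' + Pi.single i 1 ∧ Relation.ReflTransGen Sp (st i a') x := by
    intro a x h
    refine Relation.ReflTransGen.head_induction_on h (Or.inl Relation.ReflTransGen.refl) ?_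
    intro a' b hab hbx ih
    obtain ⟨haB, i, rfl⟩ := hab
    rcases hF i a' with hFb | hFb
    · have hab' : Fr a' (st i a') := ⟨i, rfl, hFb⟩
      rcases ih with h | ⟨a'', ha'', hB'', j, hj, hjx⟩
      · exact Or.inl (Relation.ReflTransGen.head hab' h)
      · exact Or.inr ⟨a'', Relation.ReflTransGen.head hab' ha'', hB'', j, hj, hjx⟩
    · exact Or.inr ⟨a', Relation.ReflTransGen.refl, haB, i, hFb, hbx⟩
  suffices h : ∀ (n : ℕ) (v : V), K - (F v 0 + F v 1) < n → {x | Relation.ReflTransGen Sp v x}.Finite from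
    h ((K - (F v 0 + F v 1)).toNat + 1) v (by have := Int.self_le_toNat (K - (F v 0 + F v 1)); push_cast; omega)
  intro n
  induction n with
  | zero =>
    intro v hv
    refine (Set.finite_singleton v).subset fun x hx => ?_
    rcases Relation.ReflTransGen.cases_head hx with rfl | ⟨b, ⟨hvB, -⟩, -⟩
    · rfl
    · have := hB _ hvB; push_cast at hv; omega
  | succ n ih =>
    intro v hv
    have hfr := hfin v
    refine (hfr.union (hfr.biUnion fun a ha => Set.finite_iUnion fun i : Fin 2 =>
      (?_ : {x | F (st i a) = F a + Pi.single i 1 ∧ Relation.ReflTransGen Sp (st i a) x}.Finite))).subset fun x hx => ?_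
    · by_cases hup : F (st i a) = F a + Pi.single i 1
      · refine (ih (st i a) ?_).subset fun x hx => hx.2
        have hFa : F a = F v := hFr ha
        have hs : F (st i a) 0 + F (st i a) 1 = F v 0 + F v 1 + 1 := by
          rw [hup, hFa, Pi.add_apply, Pi.add_apply]; linarith [single_sum_two i]
        push_cast at hv ⊢; omega
      · exact (Set.finite_empty).subset fun x hx => (hup hx.1).elim
    · rcases hdec hx with h | ⟨a', ha', -, i, hi, hix⟩
      · exact Or.inl h
      · exact Or.inr (Set.mem_biUnion ha' (Set.mem_iUnion.mpr ⟨i, hi, hix⟩))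

end Skelφ

end Summit.CriticalPhenomena.PercolationContinuityZ3.Theorems.Transplant

end
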